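import Literature.NumberTheory.Weil1965.ThetaIntegralOrbitFunctionalSupport
import HarnessLib

/-!
# The geometric action as homeomorphisms of `𝔸_F^m`, and the invariance plugs of the orbit functional in binder shape

Topic `NumberTheory/Weil1965`; namespaces `Literature.NumberTheory.Weil1965` (§1, generic) and
`Literature.NumberTheory.Weil1965.UnitaryDoubling` (§2, the dual pair).  ONE definition (`actHomeomorph`, the action
`A : G →* (𝔸_F^m ≃ₗ 𝔸_F^m)` read as homeomorphisms — every `𝔸_F`-linear self-map of the finite free module `𝔸_F^m` is continuous)
and the plugs, IN THE BINDER SHAPES of ★ `AdelicFibreMeasures.map_fibreMeasure_eq` ∕ ★ `FibreMeasureSplitPlace` (A-p08)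
(`T : _ → (X ≃ₜ X)`, `hTh : h (T g x) = h x`, `hTS : Φ ∘ T g ∈ 𝒮`, `hST : S ⟨Ψ ∘ T g, _⟩ = S Ψ`), for the orbit functional
`Λ(Φ) = ∫_{G/Γ} Σ'_{ξ≠0} Φ(A(g) ξ) dν` of ★ `ThetaIntegralOrbitFunctional` and the dual pair's `Λ_θ` (`A = vDiagAct`, `h = hNorm`):
* §1 `actHomeomorph`, `coe_actHomeomorph` (`⇑(actHomeomorph F A g) = ⇑(A g)`, `rfl`), `actHomeomorph_symm_apply`;
  **`comp_act_mem_piSchwartzBruhat`** (`hTS`: `Φ ∘ A(g) = twist L_g Φ ∈ 𝒮`, ★ `twist_actTwistGL`, ★ `twist_mem`);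
  **`orbitFunctionalReal_comp_act`** (`hST`: ★ `orbitFunctionalReal_comp` in binder shape); `map_fibreMeasure_orbitFunctionalReal_eq'`
  (★ `map_fibreMeasure_orbitFunctionalReal_eq` through `actHomeomorph`);
* §2 **`comp_vDiagAct_mem_piSchwartzBruhat`**, **`thetaOrbitFunctionalReal_comp_vDiagAct`**, `map_fibreMeasure_thetaOrbitFunctionalReal_eq'`
  (`hTh` is ★ `hNorm_vDiagAct`).

## References
* [Weil1965] A. Weil, *Sur la formule de Siegel dans la théorie des groupes classiques*, Acta Math. 113 (1965): Chap. IV n° 45–46,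
  p. 66; n° 52.
-/

set_option autoImplicit false

noncomputable section

namespace Literature.NumberTheory.Weil1965

open Literature.NumberTheory.Automorphic Literature.NumberTheory.Weil1964
open NumberField _root_.MeasureTheory _root_.Topology
open scoped Matrix

/-! ### §1 Generic -/

section Generic

variable (F : Type) [Field F] [NumberField F] {m : ℕ}
variable {G : Type*} [Group G] [TopologicalSpace G] [IsTopologicalGroup G] [LocallyCompactSpace G]
variable (Γ : Subgroup G) [CompactSpace (G ⧸ Γ)] [MeasurableSpace (G ⧸ Γ)] [BorelSpace (G ⧸ Γ)]
variable (ν : Measure (G ⧸ Γ)) [IsFiniteMeasure ν]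
variable (A : G →* ((Fin m → AdeleRing (𝓞 F) F) ≃ₗ[AdeleRing (𝓞 F) F] (Fin m → AdeleRing (𝓞 F) F)))
variable (hA : ∀ x : Fin m → AdeleRing (𝓞 F) F, Continuous fun g => A g x)
variable (hΓ : ∀ γ ∈ Γ, ∀ ξ : Fin m → F, ∃ ξ' : Fin m → F, A γ (ratPt F (Fin m) ξ) = ratPt F (Fin m) ξ')

/-- **the geometric action as homeomorphisms** `a_g : 𝔸_F^m ≃ₜ 𝔸_F^m` (an `𝔸_F`-linear automorphism of the finite free module is
bicontinuous, `LinearMap.continuous_on_pi`). [cite: Weil1965, Chap. IV n° 45, p. 66] -/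
def actHomeomorph (g : G) : (Fin m → AdeleRing (𝓞 F) F) ≃ₜ (Fin m → AdeleRing (𝓞 F) F) where
  toEquiv := (A g).toEquiv
  continuous_toFun := LinearMap.continuous_on_pi (A g).toLinearMap
  continuous_invFun := LinearMap.continuous_on_pi (A g).symm.toLinearMap

omit [TopologicalSpace G] [IsTopologicalGroup G] [LocallyCompactSpace G] in
/-- `⇑(actHomeomorph F A g) = ⇑(A g)` (definitional). [cite: Weil1965, Chap. IV n° 45, p. 66] -/
@[simp] theorem coe_actHomeomorph (g : G) : ⇑(actHomeomorph F A g) = ⇑(A g) := rfl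

omit [TopologicalSpace G] [IsTopologicalGroup G] [LocallyCompactSpace G] in
/-- pointwise form. [cite: Weil1965, Chap. IV n° 45, p. 66] -/
theorem actHomeomorph_apply (g : G) (x : Fin m → AdeleRing (𝓞 F) F) : actHomeomorph F A g x = A g x := rfl

omit [TopologicalSpace G] [IsTopologicalGroup G] [LocallyCompactSpace G] in
/-- the inverse homeomorphism is the inverse action (definitional). [cite: Weil1965, Chap. IV n° 45, p. 66] -/
theorem actHomeomorph_symm_apply (g : G) (x : Fin m → AdeleRing (𝓞 F) F) : (actHomeomorph F A g).symm x = (A g).symm x := rfl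

omit [TopologicalSpace G] [IsTopologicalGroup G] [LocallyCompactSpace G] in
/-- the inverse homeomorphism is the action of `g⁻¹`. [cite: Weil1965, Chap. IV n° 45, p. 66] -/
theorem actHomeomorph_inv (g : G) : actHomeomorph F A g⁻¹ = (actHomeomorph F A g).symm :=
  Homeomorph.ext fun x => by
    rw [actHomeomorph_apply, actHomeomorph_symm_apply, map_inv]
    rfl

omit [TopologicalSpace G] [IsTopologicalGroup G] [LocallyCompactSpace G] in
/-- **`hTS` — `𝒮(𝔸_F^m)` IS STABLE UNDER THE ACTION**: `Φ ∘ A(g) = twist L_g Φ ∈ 𝒮` (★ `twist_actTwistGL`, ★ `twist_mem`).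
[cite: Weil1965, Chap. IV n° 45, p. 66] -/
theorem comp_act_mem_piSchwartzBruhat (g : G) {Φ : (Fin m → AdeleRing (𝓞 F) F) → ℂ} (hΦ : Φ ∈ piSchwartzBruhat F (Fin m)) :
    Φ ∘ ⇑(A g) ∈ piSchwartzBruhat F (Fin m) := by
  have hc : Φ ∘ ⇑(A g) = twist F (actTwistGL F A g) Φ := funext fun x => (twist_actTwistGL F A g Φ x).symm
  rw [hc]
  exact twist_mem hΦ _

omit [TopologicalSpace G] [IsTopologicalGroup G] [LocallyCompactSpace G] in
/-- the same through `actHomeomorph` (the binder `hTS` of ★ `map_fibreMeasure_eq` verbatim). [cite: Weil1965, Chap. IV n° 45, p. 66] -/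
theorem comp_actHomeomorph_mem_piSchwartzBruhat (g : G) :
    ∀ Φ ∈ piSchwartzBruhat F (Fin m), Φ ∘ ⇑(actHomeomorph F A g) ∈ piSchwartzBruhat F (Fin m) :=
  fun _ hΦ => comp_act_mem_piSchwartzBruhat F A g hΦ

include hA in
/-- **`hST` — INVARIANCE OF `Λ_ℝ` IN BINDER SHAPE**: `Λ_ℝ ⟨Ψ ∘ A(g), _⟩ = Λ_ℝ Ψ` for `ν` invariant (★ `orbitFunctionalReal_comp`).
[cite: Weil1965, Chap. IV n° 46, p. 66] -/
theorem orbitFunctionalReal_comp_act [SMulInvariantMeasure G (G ⧸ Γ) ν] (g : G) (Ψ : piSchwartzBruhatReal F (Fin m))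
    (hΨT : (Ψ : (Fin m → AdeleRing (𝓞 F) F) → ℝ) ∘ ⇑(A g) ∈ piSchwartzBruhatReal F (Fin m)) :
    orbitFunctionalReal F Γ ν A hA hΓ ⟨(Ψ : (Fin m → AdeleRing (𝓞 F) F) → ℝ) ∘ ⇑(A g), hΨT⟩ =
      orbitFunctionalReal F Γ ν A hA hΓ Ψ :=
  orbitFunctionalReal_comp F Γ ν A hA hΓ g Ψ ⟨_, hΨT⟩ fun _ => rfl

include hA in
/-- the same through `actHomeomorph` (the binder `hST` of ★ `map_fibreMeasure_eq` verbatim). [cite: Weil1965, Chap. IV n° 46, p. 66] -/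
theorem orbitFunctionalReal_comp_actHomeomorph [SMulInvariantMeasure G (G ⧸ Γ) ν] (g : G) :
    ∀ (Ψ : piSchwartzBruhatReal F (Fin m))
      (hΨT : (Ψ : (Fin m → AdeleRing (𝓞 F) F) → ℝ) ∘ ⇑(actHomeomorph F A g) ∈ piSchwartzBruhatReal F (Fin m)),
      orbitFunctionalReal F Γ ν A hA hΓ ⟨(Ψ : (Fin m → AdeleRing (𝓞 F) F) → ℝ) ∘ ⇑(actHomeomorph F A g), hΨT⟩ =
        orbitFunctionalReal F Γ ν A hA hΓ Ψ :=
  fun Ψ hΨT => orbitFunctionalReal_comp_act F Γ ν A hA hΓ g Ψ hΨT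

include hA in
/-- **the action preserves every fibre measure**, stated through `actHomeomorph` (★ `map_fibreMeasure_orbitFunctionalReal_eq`).
[cite: Weil1965, Chap. IV n° 46, p. 66] -/
theorem map_actHomeomorph_fibreMeasure_orbitFunctionalReal_eq [MeasurableSpace (AdeleRing (𝓞 F) F)]
    [BorelSpace (AdeleRing (𝓞 F) F)] [SMulInvariantMeasure G (G ⧸ Γ) ν]
    (h : (Fin m → AdeleRing (𝓞 F) F) → AdeleRing (𝓞 F) F)
    (hinv : ∀ (g : G) (x : Fin m → AdeleRing (𝓞 F) F), h (A g x) = h x) (g : G) (b : F) :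
    (fibreMeasure F (Fin m) (orbitFunctionalReal F Γ ν A hA hΓ) (orbitFunctionalReal_nonneg F Γ ν A hA hΓ) h b).map
        (actHomeomorph F A g) =
      fibreMeasure F (Fin m) (orbitFunctionalReal F Γ ν A hA hΓ) (orbitFunctionalReal_nonneg F Γ ν A hA hΓ) h b :=
  map_fibreMeasure_orbitFunctionalReal_eq F Γ ν A hA hΓ h hinv g b

end Generic

end Literature.NumberTheory.Weil1965

/-! ### §2 The dual pair -/

namespace Literature.NumberTheory.Weil1965.UnitaryDoubling

open _root_.MeasureTheory NumberField
open Literature.NumberTheory.Weil1964 Literature.NumberTheory.Weil1965 Literature.NumberTheory.Automorphic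
open Literature.NumberTheory.GelbartRogawski1991 Literature.NumberTheory.GelbartRogawski1991.UnitaryDualPair

section DualPair

variable (F E : Type) [Field F] [NumberField F] [Field E] [NumberField E] [Algebra F E] [Algebra.IsQuadraticExtension F E]
  (c : E ≃ₐ[F] E) {δ : E} (hcδ : c δ = -δ) (hδ : δ ≠ 0) {d : F} (hd : δ * δ = algebraMap F E d)
  (N : ℕ) {n : ℕ} (e : Fin N × Fin 1 ≃ Fin n)
  (TV : Matrix (Fin N) (Fin N) F) (hV : TV.IsSymm) (hVd : IsUnit TV.det)
  (TW : Matrix (Fin 1) (Fin 1) F) (hW : TW.IsSymm) (hWd : IsUnit TW.det)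

/-- **`hTS` for the dual pair**: `Φ ∘ A_h ∈ 𝒮(X□(𝔸))` for `h ∈ U(J_V)(𝔸)`. [cite: Weil1965, Chap. IV n° 45, p. 66; n° 52] -/
theorem comp_vDiagAct_mem_piSchwartzBruhat (h : UnitaryGroup.adelic F E c N (TV.map (algebraMap F E)))
    {Φ : (Fin (n + n) → AdeleRing (𝓞 F) F) → ℂ} (hΦ : Φ ∈ piSchwartzBruhat F (Fin (n + n))) :
    Φ ∘ ⇑(vDiagAct F E c hcδ hδ hd N e TV hV hVd TW hW hWd h) ∈ piSchwartzBruhat F (Fin (n + n)) :=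
  comp_act_mem_piSchwartzBruhat F (vDiagAct F E c hcδ hδ hd N e TV hV hVd TW hW hWd) h hΦ

variable [LocallyCompactSpace (UnitaryGroup.adelic F E c N (TV.map (algebraMap F E)))]
  [CompactSpace (UnitaryGroup.adelic F E c N (TV.map (algebraMap F E)) ⧸ (UnitaryGroup.toAdelic F E c N (TV.map (algebraMap F E))).range)]
  [MeasurableSpace (UnitaryGroup.adelic F E c N (TV.map (algebraMap F E)) ⧸ (UnitaryGroup.toAdelic F E c N (TV.map (algebraMap F E))).range)]
  [BorelSpace (UnitaryGroup.adelic F E c N (TV.map (algebraMap F E)) ⧸ (UnitaryGroup.toAdelic F E c N (TV.map (algebraMap F E))).range)]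
  (ν : Measure (UnitaryGroup.adelic F E c N (TV.map (algebraMap F E)) ⧸ (UnitaryGroup.toAdelic F E c N (TV.map (algebraMap F E))).range)) [IsFiniteMeasure ν]
  [SMulInvariantMeasure (UnitaryGroup.adelic F E c N (TV.map (algebraMap F E)))
    (UnitaryGroup.adelic F E c N (TV.map (algebraMap F E)) ⧸ (UnitaryGroup.toAdelic F E c N (TV.map (algebraMap F E))).range) ν]

/-- **`hST` for the dual pair**: `Λ_θ,ℝ ⟨Ψ ∘ A_h, _⟩ = Λ_θ,ℝ Ψ` (`ν` invariant). [cite: Weil1965, Chap. IV n° 46, p. 66; n° 52] -/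
theorem thetaOrbitFunctionalReal_comp_vDiagAct (h : UnitaryGroup.adelic F E c N (TV.map (algebraMap F E)))
    (Ψ : piSchwartzBruhatReal F (Fin (n + n)))
    (hΨT : (Ψ : (Fin (n + n) → AdeleRing (𝓞 F) F) → ℝ) ∘ ⇑(vDiagAct F E c hcδ hδ hd N e TV hV hVd TW hW hWd h) ∈
      piSchwartzBruhatReal F (Fin (n + n))) :
    thetaOrbitFunctionalReal F E c hcδ hδ hd N e TV hV hVd TW hW hWd ν
        ⟨(Ψ : (Fin (n + n) → AdeleRing (𝓞 F) F) → ℝ) ∘ ⇑(vDiagAct F E c hcδ hδ hd N e TV hV hVd TW hW hWd h), hΨT⟩ =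
      thetaOrbitFunctionalReal F E c hcδ hδ hd N e TV hV hVd TW hW hWd ν Ψ :=
  orbitFunctionalReal_comp_act F (UnitaryGroup.toAdelic F E c N (TV.map (algebraMap F E))).range ν
    (vDiagAct F E c hcδ hδ hd N e TV hV hVd TW hW hWd) (continuous_vDiagAct_apply F E c hcδ hδ hd N e TV hV hVd TW hW hWd)
    (vDiagAct_ratPt_of_mem F E c hcδ hδ hd N e TV hV hVd TW hW hWd) h Ψ hΨT

/-- **the theta-side fibre measures are invariant**, stated through `actHomeomorph` (★ `map_fibreMeasure_thetaOrbitFunctionalReal_eq`).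
[cite: Weil1965, Chap. IV n° 46, p. 66; n° 52] -/
theorem map_actHomeomorph_fibreMeasure_thetaOrbitFunctionalReal_eq [MeasurableSpace (AdeleRing (𝓞 F) F)]
    [BorelSpace (AdeleRing (𝓞 F) F)] (h : UnitaryGroup.adelic F E c N (TV.map (algebraMap F E))) (b : F) :
    (fibreMeasure F (Fin (n + n)) (thetaOrbitFunctionalReal F E c hcδ hδ hd N e TV hV hVd TW hW hWd ν)
        (thetaOrbitFunctionalReal_nonneg F E c hcδ hδ hd N e TV hV hVd TW hW hWd ν)
        (hNorm F E c hcδ hδ N e TV hVd TW hWd) b).map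
        (actHomeomorph F (vDiagAct F E c hcδ hδ hd N e TV hV hVd TW hW hWd) h) =
      fibreMeasure F (Fin (n + n)) (thetaOrbitFunctionalReal F E c hcδ hδ hd N e TV hV hVd TW hW hWd ν)
        (thetaOrbitFunctionalReal_nonneg F E c hcδ hδ hd N e TV hV hVd TW hW hWd ν)
        (hNorm F E c hcδ hδ N e TV hVd TW hWd) b :=
  map_fibreMeasure_thetaOrbitFunctionalReal_eq F E c hcδ hδ hd N e TV hV hVd TW hW hWd ν h b

end DualPair

end Literature.NumberTheory.Weil1965.UnitaryDoubling
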